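import Summits.Ventures.PercRepro.Night2LocalS6Rows

/-!
# PercRepro — the rule R1 at a type-`(2, 1)` flat: residual triangles (night-2, gen 10)

The S6 weights (`Night2LocalS6Defs`) are a fractional matching only for the member family of the plane statement
(T21) of NIGHT-2-local.md §19 ADDENDUM 2; the members `membersIn M (Uq M 5 3) G` of a type-`(2, 1)` flat can be
more (proofs/NIGHT-2-r1.md §1: a layer-`0` member `B ⊆ P` needs `ρ(G ∖ B) ≥ 3`, not «`P ∖ B` spans `P`»), and
then the S6 columns overload (`5/4` at the `5`-point near-pencil).  Rule R1 repairs this: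

* a member `B` with `|G ∖ cl B| = m ≥ 2` puts `(5/4)/(m + 2)` on each covering set `B ∪ {z}` (as S6);
* a member with `|G ∖ cl B| = 1` and `|B| ≥ 4` puts `5/12` on its covering set (identity);
* a `3`-element member `B` with `|G ∖ cl B| = 1` keeps `keepW = max 0 (min (5/12) (1 − sideSum B))` on its covering
  set and spreads the rest, `5/12 − keepW`, evenly over the `|G| − 4` sets `B ∪ (G ∖ cl B) ∪ {x}`, `x ∈ cl B ∖ B`;
  `sideSum B` = the sum over the pairs `K ⊆ B` with `ρ(G ∖ (K ∪ (G ∖ cl B))) ≥ 3` of `(5/4)/(|cl B ∖ cl K| + 2)`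
  — the covering load the set `B ∪ (G ∖ cl B)` can receive from the line members `K ∪ (G ∖ cl B)`.

This file: the definitions, nonnegativity, support, the exact rows (every member's weights sum to
`(5/4)·localWeight`), and the reduction of the type-`(2, 1)` local form and of the `(5, 3)` diagonal shadow form
to «every R1 column is `≤ 1`» (`localShadowHall_of_r1W_columns`, `shadowHall_five_three_of_r1W_columns`).
The column bounds themselves are the files `Night2LocalR1Col*`.
-/

namespace PercRepro.Shadow

open Finset PerFlat ThmH

variable {α : Type*} [DecidableEq α]

open scoped Classical in
/-- The side sum `σ⁺(B)` of a `3`-element member `B` at `G`: over the pairs `K ⊆ B` whose «line member»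
`K ∪ (G ∖ cl B)` has a complement of rank `≥ 3` in `G`, the weight `(5/4)/(|cl B ∖ cl K| + 2)`. -/
noncomputable def sideSum (M : Matroid α) [M.Finite] (G B : Finset α) : ℚ :=
  ∑ K ∈ (B.powersetCard 2).filter (fun K => 3 ≤ rkN M (G \ (K ∪ (G \ clF M B)))),
    (5 / 4) / (((clF M B \ clF M K).card : ℚ) + 2)

/-- What a `3`-element member keeps on its covering set: `max 0 (min (5/12) (1 − σ⁺(B)))`. -/
noncomputable def keepW (M : Matroid α) [M.Finite] (G B : Finset α) : ℚ :=
  max 0 (min (5 / 12) (1 - sideSum M G B))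

open scoped Classical in
/-- The weight a member `B` puts on each of its covering sets under R1. -/
noncomputable def covW (M : Matroid α) [M.Finite] (G B : Finset α) : ℚ :=
  if (G \ clF M B).card = 1 then (if B.card = 3 then keepW M G B else 5 / 12)
  else (5 / 4) / (((G \ clF M B).card : ℚ) + 2)

open scoped Classical in
/-- **The R1 weight `w(B, S)`**: the covering part plus, for `3`-element members with `|G ∖ cl B| = 1`, the spread
`(5/12 − keepW)/(|G| − 4)` on the sets `S` with `B ∪ (G ∖ cl B) ⊆ S ⊆ G`, `|S ∖ B| = 2`. -/
noncomputable def r1W (M : Matroid α) [M.Finite] (G B S : Finset α) : ℚ :=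
  (if S ∈ coverSets M B G then covW M G B else 0) +
    (if (G \ clF M B).card = 1 ∧ B.card = 3 ∧ (B ∪ (G \ clF M B) ⊆ S ∧ S ⊆ G ∧ (S \ B).card = 2) then
      (5 / 12 - keepW M G B) / ((G.card - 4 : ℕ) : ℚ) else 0)

variable {M : Matroid α} [M.Finite]

/-- `0 ≤ keepW`. -/
theorem keepW_nonneg (G B : Finset α) : 0 ≤ keepW M G B := le_max_left _ _

/-- `keepW ≤ 5/12`. -/
theorem keepW_le (G B : Finset α) : keepW M G B ≤ 5 / 12 := by
  unfold keepW
  rcases le_or_gt (min (5 / 12 : ℚ) (1 - sideSum M G B)) 0 with h | h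
  · rw [max_eq_left h]; norm_num
  · rw [max_eq_right h.le]; exact min_le_left _ _

/-- `keepW ≤ 1 − σ⁺` when `σ⁺ ≤ 1`. -/
theorem keepW_le_one_sub (G B : Finset α) (h : sideSum M G B ≤ 1) : keepW M G B ≤ 1 - sideSum M G B := by
  unfold keepW
  apply max_le
  · linarith
  · exact min_le_right _ _

/-- `keepW = 5/12` when `σ⁺ ≤ 7/12`. -/
theorem keepW_eq_of_le (G B : Finset α) (h : sideSum M G B ≤ 7 / 12) : keepW M G B = 5 / 12 := by
  unfold keepW
  rw [min_eq_left (by linarith), max_eq_right (by norm_num)]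

/-- The spread `5/12 − keepW` is at most `max 0 (σ⁺ − 7/12)`. -/
theorem spread_le (G B : Finset α) : 5 / 12 - keepW M G B ≤ max 0 (sideSum M G B - 7 / 12) := by
  unfold keepW
  rcases le_or_gt (sideSum M G B) (7 / 12) with h | h
  · rw [min_eq_left (by linarith), max_eq_right (by norm_num)]
    linarith [le_max_left (0 : ℚ) (sideSum M G B - 7 / 12)]
  · rcases le_or_gt (sideSum M G B) 1 with h1 | h1
    · rw [min_eq_right (by linarith), max_eq_right (by linarith)]
      linarith [le_max_right (0 : ℚ) (sideSum M G B - 7 / 12)]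
    · rw [min_eq_right (by linarith), max_eq_left (by linarith)]
      linarith [le_max_right (0 : ℚ) (sideSum M G B - 7 / 12)]

/-- `0 ≤ covW`. -/
theorem covW_nonneg (G B : Finset α) : 0 ≤ covW M G B := by
  unfold covW
  split_ifs
  · exact keepW_nonneg G B
  · norm_num
  · positivity

/-- `covW ≤ 5/12` once `G ∖ cl B` is nonempty. -/
theorem covW_le (G B : Finset α) (hm : 1 ≤ (G \ clF M B).card) : covW M G B ≤ 5 / 12 := by
  unfold covW
  split_ifs with h1 h2
  · exact keepW_le G B
  · exact le_refl _
  · have hm2 : (2 : ℚ) ≤ ((G \ clF M B).card : ℚ) := by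
      exact_mod_cast (Nat.lt_of_le_of_ne hm (Ne.symm h1) : 1 < (G \ clF M B).card)
    rw [div_le_iff₀ (by linarith)]
    linarith

/-- `covW ≤ (5/4)/(m + 2)` with `m = |G ∖ cl B|` (for `m = 1` both sides are at most `5/12`). -/
theorem covW_le_cov (G B : Finset α) :
    covW M G B ≤ (5 / 4) / (((G \ clF M B).card : ℚ) + 2) := by
  unfold covW
  split_ifs with h1 h2
  · rw [h1]; push_cast
    calc keepW M G B ≤ 5 / 12 := keepW_le G B
      _ = (5 / 4) / (1 + 2) := by norm_num
  · rw [h1]; push_cast; norm_num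
  · exact le_refl _

/-- The R1 weights are nonnegative. -/
theorem r1W_nonneg (G B S : Finset α) : 0 ≤ r1W M G B S := by
  unfold r1W
  apply add_nonneg
  · split_ifs
    · exact covW_nonneg G B
    · exact le_refl _
  · split_ifs
    · apply div_nonneg
      · linarith [keepW_le (M := M) G B]
      · positivity
    · exact le_refl _

open scoped Classical in
/-- A nonzero R1 weight `w(B, S)` has `B ⊆ S`. -/
theorem subset_of_r1W_ne_zero {G B S : Finset α} (h : r1W M G B S ≠ 0) : B ⊆ S := by
  unfold r1W at h
  by_cases hc : S ∈ coverSets M B G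
  · obtain ⟨z, -, rfl⟩ := mem_coverSets.1 hc
    exact Finset.subset_insert _ _
  · rw [if_neg hc, zero_add] at h
    split_ifs at h with hp
    · exact (Finset.subset_union_left).trans hp.2.2.1
    · exact absurd rfl h

/-! ## Rows -/

open scoped Classical in
/-- Row sum of a member with `m ≠ 1`: exactly `(5/4)·m/(m + 2)`. -/
theorem sum_r1W_of_ne_one {q : ℕ} {𝒜 : Finset (Finset α)} (h𝒜 : 𝒜 ⊆ Uq M (q + 2) q) {G : Finset α}
    (hG : G ∈ flatsQ M (q + 1)) {B : Finset α} (hB : B ∈ membersIn M 𝒜 G) (hm : (G \ clF M B).card ≠ 1) :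
    ∑ S ∈ shadowAt M (q + 2) q 𝒜 G, r1W M G B S =
      (5 / 4) * (((G \ clF M B).card : ℚ) / (((G \ clF M B).card : ℚ) + 2)) := by
  have hBU : B ∈ Uq M (q + 2) q := h𝒜 (mem_membersIn.1 hB).1
  have hsub := coverSets_subset_shadowAt h𝒜 hG hB
  have hcov : covW M G B = (5 / 4) / (((G \ clF M B).card : ℚ) + 2) := by
    unfold covW; rw [if_neg hm]
  have hrow : ∀ S ∈ shadowAt M (q + 2) q 𝒜 G, r1W M G B S =
      if S ∈ coverSets M B G then (5 / 4) / (((G \ clF M B).card : ℚ) + 2) else 0 := by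
    intro S _
    have hnot : ¬ ((G \ clF M B).card = 1 ∧ B.card = 3 ∧
        (B ∪ (G \ clF M B) ⊆ S ∧ S ⊆ G ∧ (S \ B).card = 2)) := fun h => hm h.1
    unfold r1W
    rw [if_neg hnot, add_zero, hcov]
  rw [Finset.sum_congr rfl hrow, ← Finset.sum_filter, Finset.filter_mem_eq_inter,
    Finset.inter_eq_right.2 hsub, Finset.sum_const, card_coverSets hBU, nsmul_eq_mul]
  field_simp

open scoped Classical in
/-- Row sum of a member with `m = 1` and `|B| ≥ 4`: exactly `5/12`. -/
theorem sum_r1W_of_eq_one_of_four_le {q : ℕ} {𝒜 : Finset (Finset α)} (h𝒜 : 𝒜 ⊆ Uq M (q + 2) q) {G : Finset α}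
    (hG : G ∈ flatsQ M (q + 1)) {B : Finset α} (hB : B ∈ membersIn M 𝒜 G) (hm : (G \ clF M B).card = 1)
    (h4 : 4 ≤ B.card) : ∑ S ∈ shadowAt M (q + 2) q 𝒜 G, r1W M G B S = 5 / 12 := by
  have hcov : covW M G B = 5 / 12 := by
    unfold covW; rw [if_pos hm, if_neg (by omega)]
  have hrow : ∀ S ∈ shadowAt M (q + 2) q 𝒜 G, r1W M G B S =
      if S ∈ coverSets M B G then 5 / 12 else 0 := by
    intro S _
    have hnot : ¬ ((G \ clF M B).card = 1 ∧ B.card = 3 ∧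
        (B ∪ (G \ clF M B) ⊆ S ∧ S ⊆ G ∧ (S \ B).card = 2)) := by
      rintro ⟨-, h, -⟩; omega
    unfold r1W
    rw [if_neg hnot, add_zero, hcov]
  rw [Finset.sum_congr rfl hrow, sum_ite_coverSets_of_eq_one h𝒜 hG hB hm]

open scoped Classical in
/-- Row sum of a `3`-element member with `m = 1` (`q = 3`, `5 ≤ |G|`): exactly `5/12`. -/
theorem sum_r1W_of_eq_one_of_card_three {𝒜 : Finset (Finset α)} (h𝒜 : 𝒜 ⊆ Uq M 5 3) {G : Finset α}
    (hG : G ∈ flatsQ M 4) (h5 : 5 ≤ G.card) {B : Finset α} (hB : B ∈ membersIn M 𝒜 G)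
    (hm : (G \ clF M B).card = 1) (h3 : B.card = 3) :
    ∑ S ∈ shadowAt M 5 3 𝒜 G, r1W M G B S = 5 / 12 := by
  have hBg : B ⊆ gr M := (mem_Uq.1 (h𝒜 (mem_membersIn.1 hB).1)).1
  have hclB : clF M B ⊆ G := (mem_membersIn.1 hB).2
  have hrow : ∀ S ∈ shadowAt M 5 3 𝒜 G, r1W M G B S =
      (if S ∈ coverSets M B G then keepW M G B else 0) +
        (if B ∪ (G \ clF M B) ⊆ S ∧ S ⊆ G ∧ (S \ B).card = 2 then
          (5 / 12 - keepW M G B) / ((G.card - 4 : ℕ) : ℚ) else 0) := by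
    intro S _
    have hcov : covW M G B = keepW M G B := by
      unfold covW; rw [if_pos hm, if_pos h3]
    unfold r1W
    rw [hcov]
    congr 1
    by_cases hp : B ∪ (G \ clF M B) ⊆ S ∧ S ⊆ G ∧ (S \ B).card = 2
    · rw [if_pos ⟨hm, h3, hp⟩, if_pos hp]
    · rw [if_neg (fun h => hp h.2.2), if_neg hp]
  rw [Finset.sum_congr rfl hrow, Finset.sum_add_distrib, sum_ite_coverSets_of_eq_one (q := 3) h𝒜 hG hB hm,
    ← Finset.sum_filter, filter_spread_eq_spreadSets h𝒜 hG hB hm, Finset.sum_const, card_spreadSets,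
    card_clF_sdiff_of_card_three hBg hclB hm h3, nsmul_eq_mul]
  have hpos : (0 : ℚ) < ((G.card - 4 : ℕ) : ℚ) := by exact_mod_cast (by omega : 0 < G.card - 4)
  field_simp
  ring

open scoped Classical in
/-- **Every row of R1 is exact** (`q = 3`, `|E ∖ G| = 2`, `|G| ≥ 6`): the weights of a member `B` sum to
`(5/4)·localWeight M B G`. -/
theorem sum_r1W_row {G : Finset α} (hG : G ∈ flatsQ M 4) (hd : (gr M \ G).card = 2) (h6 : 6 ≤ G.card)
    {B : Finset α} (hB : B ∈ membersIn M (Uq M 5 3) G) :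
    ∑ S ∈ shadowAt M 5 3 (Uq M 5 3) G, r1W M G B S = (5 / 4) * localWeight M B G := by
  have hBU : B ∈ Uq M 5 3 := (mem_membersIn.1 hB).1
  have hclB : clF M B ⊆ G := (mem_membersIn.1 hB).2
  have hlw : localWeight M B G = ((G \ clF M B).card : ℚ) / (((G \ clF M B).card : ℚ) + 2) := by
    unfold localWeight
    rw [card_compl_clF_add (q := 3) hG hclB, hd]
    push_cast
    ring
  rw [hlw]
  by_cases hm : (G \ clF M B).card = 1
  · rw [hm]
    have hB3 : 3 ≤ B.card := by
      have h1 : rkN M B = 3 := by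
        unfold rkN; rw [(mem_Uq.1 hBU).2.1]; rfl
      have := rkN_le_card (M := M) B
      omega
    rcases Nat.lt_or_ge B.card 4 with h3 | h4
    · rw [sum_r1W_of_eq_one_of_card_three (Finset.Subset.refl _) hG (by omega) hB hm (by omega)]
      norm_num
    · rw [sum_r1W_of_eq_one_of_four_le (q := 3) (Finset.Subset.refl _) hG hB hm h4]
      norm_num
  · exact sum_r1W_of_ne_one (q := 3) (Finset.Subset.refl _) hG hB hm

/-! ## The reduction to the R1 column bound -/

open scoped Classical in
/-- **The type `(2, 1)` local form follows from the R1 column bound**: if every shadow set at `G` carries R1 load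
`≤ 1`, then `LocalShadowHall M 3 G` (`|E ∖ G| = 2`, `|G| ≥ 6`). -/
theorem localShadowHall_of_r1W_columns {G : Finset α} (hG : G ∈ flatsQ M 4) (hd : (gr M \ G).card = 2)
    (h6 : 6 ≤ G.card)
    (hcol : ∀ S ∈ shadowAt M 5 3 (Uq M 5 3) G, ∑ B ∈ membersIn M (Uq M 5 3) G, r1W M G B S ≤ 1) :
    LocalShadowHall M 3 G := by
  apply localShadowHall_of_full_matching (r1W M G)
  · exact fun B S => r1W_nonneg G B S
  · exact fun B S h => subset_of_r1W_ne_zero h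
  · exact hcol
  · intro B hB
    rw [sum_r1W_row hG hd h6 hB]
    norm_num

open scoped Classical in
/-- **The `(5, 3)` diagonal shadow form modulo the R1 column bound at the type-`(2, 1)` flats.** -/
theorem shadowHall_five_three_of_r1W_columns (hl : ∀ e ∈ gr M, M.IsNonloop e)
    (hrk : M.eRk ((gr M : Finset α) : Set α) = ((5 : ℕ) : ℕ∞))
    (hcol : ∀ G ∈ flatsQ M 4, (gr M \ G).card = 2 →
      (∃ B ∈ membersIn M (Uq M 5 3) G, (G \ clF M B).card = 1) → 6 ≤ G.card →
      ∀ S ∈ shadowAt M 5 3 (Uq M 5 3) G, ∑ B ∈ membersIn M (Uq M 5 3) G, r1W M G B S ≤ 1) :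
    ShadowHall M 5 3 (((3 : ℕ) + 2 : ℚ) / ((3 : ℕ) + 1 : ℚ)) := by
  apply shadowHall_five_three_of_two_one hl hrk
  intro G hG hd hex
  have h6 : 6 ≤ G.card := by
    obtain ⟨B, hB, -⟩ := hex
    have hBU : B ∈ Uq M 5 3 := (mem_membersIn.1 hB).1
    have hclB : clF M B ⊆ G := (mem_membersIn.1 hB).2
    have hBg : B ⊆ gr M := (mem_Uq.1 hBU).1
    have h5 : 5 ≤ (gr M \ B).card := by
      have h := rkN_le_card (M := M) (gr M \ B)
      have h' : rkN M (gr M \ B) = 5 := by unfold rkN; rw [(mem_Uq.1 hBU).2.2]; rfl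
      omega
    have hsplit : (gr M \ B).card ≤ (G \ B).card + (gr M \ G).card := by
      calc (gr M \ B).card ≤ ((G \ B) ∪ (gr M \ G)).card := Finset.card_le_card (by
            intro e he
            rw [Finset.mem_sdiff] at he
            rw [Finset.mem_union, Finset.mem_sdiff, Finset.mem_sdiff]
            by_cases heG : e ∈ G
            · exact Or.inl ⟨heG, he.2⟩
            · exact Or.inr ⟨he.1, heG⟩)
        _ ≤ (G \ B).card + (gr M \ G).card := Finset.card_union_le _ _
    have hBG : B ⊆ G := (subset_clF_of_subset_gr hBg).trans hclB
    have h3 : 3 ≤ B.card := by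
      have h1 : rkN M B = 3 := by unfold rkN; rw [(mem_Uq.1 hBU).2.1]; rfl
      have := rkN_le_card (M := M) B
      omega
    have := Finset.card_sdiff_add_card_eq_card hBG
    omega
  exact localShadowHall_of_r1W_columns hG hd h6 (hcol G hG hd hex h6)

end PercRepro.Shadow
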